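import Summits.CriticalPhenomena.PercolationContinuityZ3.Theorems.Transplant.BccSlabProfiles
import Summits.CriticalPhenomena.PercolationContinuityZ3.Theorems.Transplant.VPathKit
import HarnessLib

/-!
# The bcc (001)-slabs: ZIGZAG PATHS between two adjacent columns (the explicit elevators of the 3D templates)

builds on p205010 (kernel theorem, internal audit signed; external expert review pending) — NOT used in this file.
Lane `prim-bschramm`, seat `prim-bschramm-p2` (gen 46; class C1b, METHOD = input substitution; memo `HOME/bschramm/P2-LATTICES.md` §156); helper file
(`--supports stmt-CriticalPhenomena-4575 --as helper`).
The exceptional (stacked) configurations of the exit-form certificate («BccClawXStack») are routed in 3D by explicit vertex lists; their building block is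
the ZIGZAG `zig k c₁ c₂ t σ n`: the `n + 1` slab vertices `(c₁, t), (c₂, t + σ), (c₁, t + 2σ), …` alternating between two lattice-adjacent columns
`c₁ ∼ c₂` with heights moving monotonically by `σ = ±1` («BccSlabPaths».`vtx`).
* §1 `zcol` (the column after `i` steps), `zig`, head / last / membership (`mem_zig`: the `i`-th vertex is `vtx (zcol c₁ c₂ i) (t + σ i)`);
* §2 admissibility along the zigzag (`adm_zcol`) and **`gpath_zig`**: the zigzag is a self-avoiding slab path (strictly monotone heights);
  `sh_ht_of_mem_zig` (columns in `{c₁, c₂}`, heights `t + σ i`, `i ≤ n`).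
[cite: DuminilCopinSidoraviciusTassion2016, §2.3 (proof of Fact 2: the three disjoint paths)] [cite: ConwaySloane1999, Ch. 4 §7.1]
-/

noncomputable section

namespace Summit.CriticalPhenomena.PercolationContinuityZ3.Theorems.Transplant

namespace BccSlab

open Literature.Probability.Percolation Literature.Probability.LatticeModels SimpleGraph
open scoped Classical

variable {k : ℕ}

/-! ## §1 The zigzag and its vertices -/

/-- The column reached after `i` steps of the zigzag starting at `c₁` (alternating `c₁, c₂, c₁, …`). [folklore] -/
def zcol (c₁ c₂ : Site 2) : ℕ → Site 2
  | 0 => c₁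
  | i + 1 => zcol c₂ c₁ i

/-- Two steps return to the same column. [folklore] -/
@[simp] theorem zcol_add_two (c₁ c₂ : Site 2) (i : ℕ) : zcol c₁ c₂ (i + 2) = zcol c₁ c₂ i := rfl

/-- The zigzag columns are `c₁` or `c₂`. [folklore] -/
theorem zcol_mem (c₁ c₂ : Site 2) : ∀ i : ℕ, zcol c₁ c₂ i = c₁ ∨ zcol c₁ c₂ i = c₂ := by
  intro i
  induction i using Nat.twoStepInduction with
  | zero => exact Or.inl rfl
  | one => exact Or.inr rfl
  | more i ih _ => rw [zcol_add_two]; exact ih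

/-- At even steps the column is `c₁`. [folklore] -/
theorem zcol_two_mul (c₁ c₂ : Site 2) (m : ℕ) : zcol c₁ c₂ (2 * m) = c₁ := by
  induction m with
  | zero => rfl
  | succ m ih => rw [show 2 * (m + 1) = 2 * m + 2 by ring, zcol_add_two, ih]

/-- At odd steps the column is `c₂`. [folklore] -/
theorem zcol_two_mul_add_one (c₁ c₂ : Site 2) (m : ℕ) : zcol c₁ c₂ (2 * m + 1) = c₂ := by
  induction m with
  | zero => rfl
  | succ m ih => rw [show 2 * (m + 1) + 1 = (2 * m + 1) + 2 by ring, zcol_add_two, ih]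

/-- Consecutive zigzag columns are lattice-adjacent. [folklore] -/
theorem zcol_adj {c₁ c₂ : Site 2} (h : (zdGraph 2).Adj c₁ c₂) : ∀ i : ℕ, (zdGraph 2).Adj (zcol c₁ c₂ i) (zcol c₁ c₂ (i + 1)) := by
  intro i
  induction i with
  | zero => exact h
  | succ i ih => rw [show i + 1 + 1 = i + 2 from rfl, zcol_add_two]; exact ih.symm

/-- **The zigzag**: `n + 1` explicit slab vertices alternating between the columns `c₁, c₂`, heights `t, t + σ, t + 2σ, …`.
[cite: DuminilCopinSidoraviciusTassion2016, §2.3 (proof of Fact 2)] -/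
def zig (k : ℕ) (c₁ c₂ : Site 2) (t σ : ℤ) : ℕ → List (bslab k)
  | 0 => [vtx k c₁ t]
  | n + 1 => vtx k c₁ t :: zig k c₂ c₁ (t + σ) σ n

/-- The zigzag is non-empty. [folklore] -/
theorem zig_ne_nil (k : ℕ) (c₁ c₂ : Site 2) (t σ : ℤ) (n : ℕ) : zig k c₁ c₂ t σ n ≠ [] := by
  cases n <;> simp [zig]

/-- Its first vertex. [folklore] -/
theorem head?_zig (k : ℕ) (c₁ c₂ : Site 2) (t σ : ℤ) (n : ℕ) : (zig k c₁ c₂ t σ n).head? = some (vtx k c₁ t) := by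
  cases n <;> rfl

/-- **Membership**: every vertex of the zigzag is `vtx (zcol c₁ c₂ i) (t + σ i)` for some `i ≤ n`. [folklore] -/
theorem mem_zig {c₁ c₂ : Site 2} {t σ : ℤ} {n : ℕ} {x : bslab k} (hx : x ∈ zig k c₁ c₂ t σ n) :
    ∃ i : ℕ, i ≤ n ∧ x = vtx k (zcol c₁ c₂ i) (t + σ * i) := by
  induction n generalizing c₁ c₂ t with
  | zero =>
    simp only [zig, List.mem_singleton] at hx
    exact ⟨0, le_rfl, by rw [hx]; simp [zcol]⟩
  | succ n ih =>
    simp only [zig, List.mem_cons] at hx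
    rcases hx with hx | hx
    · exact ⟨0, Nat.zero_le _, by rw [hx]; simp [zcol]⟩
    · obtain ⟨i, hi, rfl⟩ := ih hx
      refine ⟨i + 1, by omega, ?_⟩
      show vtx k (zcol c₂ c₁ i) (t + σ + σ * i) = vtx k (zcol c₁ c₂ (i + 1)) (t + σ * (i + 1 : ℕ))
      rw [show zcol c₁ c₂ (i + 1) = zcol c₂ c₁ i from rfl]
      congr 1; push_cast; ring

/-- Its last vertex. [folklore] -/
theorem getLast?_zig (k : ℕ) (c₁ c₂ : Site 2) (t σ : ℤ) (n : ℕ) :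
    (zig k c₁ c₂ t σ n).getLast? = some (vtx k (zcol c₁ c₂ n) (t + σ * n)) := by
  induction n generalizing c₁ c₂ t with
  | zero => simp [zig, zcol]
  | succ n ih =>
    rw [zig, List.getLast?_cons_of_ne_nil (zig_ne_nil k c₂ c₁ (t + σ) σ n), ih]
    rw [show zcol c₁ c₂ (n + 1) = zcol c₂ c₁ n from rfl]
    congr 2; push_cast; ring

/-! ## §2 The zigzag is a self-avoiding slab path -/

/-- **Admissibility along the zigzag** (`σ = ±1`, `c₁ ∼ c₂`, start admissible, far end in `[0, k]`): every `(zcol i, t + σ i)`, `i ≤ n`, is admissible.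
[folklore] -/
theorem adm_zcol {c₁ c₂ : Site 2} {t σ : ℤ} {n : ℕ} (hσ : σ = 1 ∨ σ = -1) (hadj : (zdGraph 2).Adj c₁ c₂) (hA : Adm k c₁ t)
    (hend : 0 ≤ t + σ * n ∧ t + σ * n ≤ k) : ∀ i : ℕ, i ≤ n → Adm k (zcol c₁ c₂ i) (t + σ * i) := by
  obtain ⟨h0, hk, hpar⟩ := hA
  -- parity by induction, range by monotonicity
  have hparity : ∀ i : ℕ, Even ((zcol c₁ c₂ i) 0 + (zcol c₁ c₂ i) 1 - (t + σ * i)) := by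
    intro i
    induction i with
    | zero => simpa [zcol] using hpar
    | succ i ih =>
      obtain ⟨m, hm⟩ := ih
      rcases sum_step_of_adj (zcol_adj hadj i) with e | e <;> rcases hσ with rfl | rfl
      · exact ⟨m, by push_cast; omega⟩
      · exact ⟨m + 1, by push_cast; omega⟩
      · exact ⟨m - 1, by push_cast; omega⟩
      · exact ⟨m, by push_cast; omega⟩
  intro i hi
  have hi' : (i : ℤ) ≤ n := by exact_mod_cast hi
  refine ⟨?_, ?_, hparity i⟩ <;> rcases hσ with rfl | rfl <;> omega

/-- **THE ZIGZAG IS A SELF-AVOIDING SLAB PATH** from `vtx c₁ t` to `vtx (zcol c₁ c₂ n) (t + σ n)` (strictly monotone heights).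
[cite: DuminilCopinSidoraviciusTassion2016, §2.3 (proof of Fact 2)] -/
theorem gpath_zig {c₁ c₂ : Site 2} {t σ : ℤ} {n : ℕ} (hσ : σ = 1 ∨ σ = -1) (hadj : (zdGraph 2).Adj c₁ c₂) (hA : Adm k c₁ t)
    (hend : 0 ≤ t + σ * n ∧ t + σ * n ≤ k) :
    GPath (slabGraph k) (zig k c₁ c₂ t σ n) (vtx k c₁ t) (vtx k (zcol c₁ c₂ n) (t + σ * n)) := by
  induction n generalizing c₁ c₂ t with
  | zero => simp only [zig, zcol, Nat.cast_zero, mul_zero, add_zero]; exact GPath.single _ _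
  | succ n ih =>
    have hA1 : Adm k c₂ (t + σ) := by
      have := adm_zcol hσ hadj hA hend 1 (by omega); simpa [zcol] using this
    have hend' : 0 ≤ t + σ + σ * n ∧ t + σ + σ * n ≤ k := by constructor <;> push_cast at hend <;> linarith [hend.1, hend.2]
    have htail := ih hadj.symm hA1 hend'
    have hstep : (slabGraph k).Adj (vtx k c₁ t) (vtx k c₂ (t + σ)) := adj_vtx hA hA1 hadj (by rcases hσ with rfl | rfl <;> [simp; (right; ring)])
    have hnot : vtx k c₁ t ∉ zig k c₂ c₁ (t + σ) σ n := by
      intro hx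
      obtain ⟨i, hi, he⟩ := mem_zig hx
      have hAi := adm_zcol hσ hadj.symm hA1 hend' i hi
      have := ((vtx_eq_vtx_iff hA hAi).1 he).2
      rcases hσ with rfl | rfl <;> omega
    have := htail.cons hstep hnot
    rw [zig, show zcol c₁ c₂ (n + 1) = zcol c₂ c₁ n from rfl]
    have e : t + σ * ((n + 1 : ℕ) : ℤ) = t + σ + σ * n := by push_cast; ring
    rw [e]; exact this

/-- **Columns and heights of the zigzag vertices**: over `c₁` or `c₂`, at height `t + σ i` for some `i ≤ n`. [folklore] -/
theorem sh_ht_of_mem_zig {c₁ c₂ : Site 2} {t σ : ℤ} {n : ℕ} (hσ : σ = 1 ∨ σ = -1) (hadj : (zdGraph 2).Adj c₁ c₂) (hA : Adm k c₁ t)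
    (hend : 0 ≤ t + σ * n ∧ t + σ * n ≤ k) {x : bslab k} (hx : x ∈ zig k c₁ c₂ t σ n) :
    (sh x = c₁ ∨ sh x = c₂) ∧ ∃ i : ℕ, i ≤ n ∧ ht x = t + σ * i := by
  obtain ⟨i, hi, rfl⟩ := mem_zig hx
  have hAi := adm_zcol hσ hadj hA hend i hi
  rw [sh_vtx hAi, ht_vtx hAi]
  exact ⟨zcol_mem c₁ c₂ i, i, hi, rfl⟩

/-- The last vertex of the zigzag, as `getLast`. [folklore] -/
theorem getLast_zig (k : ℕ) (c₁ c₂ : Site 2) (t σ : ℤ) (n : ℕ) :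
    (zig k c₁ c₂ t σ n).getLast (zig_ne_nil k c₁ c₂ t σ n) = vtx k (zcol c₁ c₂ n) (t + σ * n) := by
  rw [List.getLast_eq_iff_getLast?_eq_some]; exact getLast?_zig k c₁ c₂ t σ n

end BccSlab

end Summit.CriticalPhenomena.PercolationContinuityZ3.Theorems.Transplant

end
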